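import Literature.Probability.LatticeModels.KCSignConfig
import HarnessLib

/-!
# Frame coordinates along a lattice direction

Topic `Literature/Probability/LatticeModels`. Elementary algebra of the orthonormal lattice frame
`(e_k, e_{k+1})` attached to a direction `k : Fin 4` — the real coordinates
`dirCoord k w`, `dirCoord (k+1) w` of a complex number (`KCSignConfig.lean`), their relation to
the integer frame coordinates `nCoord k z₀ z`, `tCoord k z₀ z` of sites
(`KCModifiedHMBarriers.lean`), reconstruction of `w` from its two coordinates, and the
description of closed unit squares in frame coordinates. Used to place the flat piece of the
sign-condition contour in an arbitrary lattice orientation (`KCSignConditionScaleFlat.lean`).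

All `[folklore]`; no named fact.
-/

noncomputable section

open Set

namespace Literature.Probability.LatticeModels

open Site

/-- Components of `cornerUnit (k+1)`: the `+90°` rotation of `cornerUnit k`. [folklore] -/
theorem cornerUnit_succ_apply (k : Fin 4) : cornerUnit (k + 1) 0 = -cornerUnit k 1 ∧ cornerUnit (k + 1) 1 = cornerUnit k 0 := by
  fin_cases k <;> simp

/-- The components of `cornerUnit k` are a signed standard basis vector. [folklore] -/
theorem cornerUnit_apply_cases (k : Fin 4) :
    (cornerUnit k 0 = 1 ∧ cornerUnit k 1 = 0) ∨ (cornerUnit k 0 = 0 ∧ cornerUnit k 1 = 1) ∨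
      (cornerUnit k 0 = -1 ∧ cornerUnit k 1 = 0) ∨ (cornerUnit k 0 = 0 ∧ cornerUnit k 1 = -1) := by
  fin_cases k <;> simp

/-- Real and imaginary parts of `dirVec k`. [folklore] -/
@[simp] theorem dirVec_re (k : Fin 4) : (dirVec k).re = cornerUnit k 0 := by simp [dirVec]

/-- Real and imaginary parts of `dirVec k`. [folklore] -/
@[simp] theorem dirVec_im (k : Fin 4) : (dirVec k).im = cornerUnit k 1 := by simp [dirVec]

/-- `dirCoord` is additive. [folklore] -/
theorem dirCoord_add (k : Fin 4) (v w : ℂ) : dirCoord k (v + w) = dirCoord k v + dirCoord k w := by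
  simp only [dirCoord, Complex.add_re, Complex.add_im]; ring

/-- `dirCoord` of a difference. [folklore] -/
theorem dirCoord_sub (k : Fin 4) (v w : ℂ) : dirCoord k (v - w) = dirCoord k v - dirCoord k w := by
  simp only [dirCoord, Complex.sub_re, Complex.sub_im]; ring

/-- `dirCoord` is homogeneous. [folklore] -/
theorem dirCoord_real_mul (k : Fin 4) (t : ℝ) (w : ℂ) : dirCoord k ((t : ℂ) * w) = t * dirCoord k w := by
  simp only [dirCoord, Complex.mul_re, Complex.mul_im, Complex.ofReal_re, Complex.ofReal_im, zero_mul, sub_zero, add_zero]; ring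

/-- The frame is orthonormal: `dirCoord k (t e_k) = t`. [folklore] -/
@[simp] theorem dirCoord_mul_dirVec_self (k : Fin 4) (t : ℝ) : dirCoord k ((t : ℂ) * dirVec k) = t := by
  rcases cornerUnit_apply_cases k with ⟨h0, h1⟩ | ⟨h0, h1⟩ | ⟨h0, h1⟩ | ⟨h0, h1⟩ <;>
    simp [dirCoord, dirVec, h0, h1]

/-- The frame is orthonormal: `dirCoord k (t e_{k+1}) = 0`. [folklore] -/
@[simp] theorem dirCoord_mul_dirVec_succ (k : Fin 4) (t : ℝ) : dirCoord k ((t : ℂ) * dirVec (k + 1)) = 0 := by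
  obtain ⟨hs0, hs1⟩ := cornerUnit_succ_apply k
  rcases cornerUnit_apply_cases k with ⟨h0, h1⟩ | ⟨h0, h1⟩ | ⟨h0, h1⟩ | ⟨h0, h1⟩ <;>
    simp [dirCoord, dirVec, hs0, hs1, h0, h1]

/-- The frame is orthonormal: `dirCoord (k+1) (t e_k) = 0`. [folklore] -/
@[simp] theorem dirCoord_succ_mul_dirVec (k : Fin 4) (t : ℝ) : dirCoord (k + 1) ((t : ℂ) * dirVec k) = 0 := by
  obtain ⟨hs0, hs1⟩ := cornerUnit_succ_apply k
  rcases cornerUnit_apply_cases k with ⟨h0, h1⟩ | ⟨h0, h1⟩ | ⟨h0, h1⟩ | ⟨h0, h1⟩ <;>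
    simp [dirCoord, dirVec, hs0, hs1, h0, h1]

/-- The frame is orthonormal: `dirCoord (k+1) (t e_{k+1}) = t`. [folklore] -/
@[simp] theorem dirCoord_succ_mul_dirVec_succ (k : Fin 4) (t : ℝ) : dirCoord (k + 1) ((t : ℂ) * dirVec (k + 1)) = t :=
  dirCoord_mul_dirVec_self (k + 1) t

/-- **Reconstruction** of `w` from its two frame coordinates. [folklore] -/
theorem eq_dirCoord_frame (k : Fin 4) (w : ℂ) :
    w = (dirCoord k w : ℂ) * dirVec k + (dirCoord (k + 1) w : ℂ) * dirVec (k + 1) := by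
  obtain ⟨hs0, hs1⟩ := cornerUnit_succ_apply k
  apply Complex.ext <;>
  rcases cornerUnit_apply_cases k with ⟨h0, h1⟩ | ⟨h0, h1⟩ | ⟨h0, h1⟩ | ⟨h0, h1⟩ <;>
    simp [dirCoord, dirVec, hs0, hs1, h0, h1]

/-- Two points with the same frame coordinates are equal. [folklore] -/
theorem eq_of_dirCoord_eq (k : Fin 4) {v w : ℂ} (hn : dirCoord k v = dirCoord k w) (ht : dirCoord (k + 1) v = dirCoord (k + 1) w) :
    v = w := by
  rw [eq_dirCoord_frame k v, eq_dirCoord_frame k w, hn, ht]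

/-- **Sup-norm in frame coordinates**: the two frame coordinates are, up to sign and order, the
real and imaginary parts. [folklore] -/
theorem abs_dirCoord_le_iff (k : Fin 4) (w : ℂ) (A : ℝ) :
    (|dirCoord k w| ≤ A ∧ |dirCoord (k + 1) w| ≤ A) ↔ (|w.re| ≤ A ∧ |w.im| ≤ A) := by
  obtain ⟨hs0, hs1⟩ := cornerUnit_succ_apply k
  rcases cornerUnit_apply_cases k with ⟨h0, h1⟩ | ⟨h0, h1⟩ | ⟨h0, h1⟩ | ⟨h0, h1⟩ <;>
    simp [dirCoord, hs0, hs1, h0, h1, abs_neg, and_comm]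

/-- The Euclidean norm is controlled by the frame coordinates. [folklore] -/
theorem norm_le_abs_dirCoord_add (k : Fin 4) (w : ℂ) : ‖w‖ ≤ |dirCoord k w| + |dirCoord (k + 1) w| := by
  obtain ⟨hs0, hs1⟩ := cornerUnit_succ_apply k
  refine (Complex.norm_le_abs_re_add_abs_im w).trans (le_of_eq ?_)
  rcases cornerUnit_apply_cases k with ⟨h0, h1⟩ | ⟨h0, h1⟩ | ⟨h0, h1⟩ | ⟨h0, h1⟩ <;>
    simp [dirCoord, hs0, hs1, h0, h1, abs_neg, add_comm]

/-- **Integer frame coordinates of sites** are the frame coordinates of the difference of their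
positions: normal coordinate. [folklore] -/
theorem nCoord_cast (k : Fin 4) (z₀ z : Site 2) : (nCoord k z₀ z : ℝ) = dirCoord k (toComplex z - toComplex z₀) := by
  simp [nCoord, dirCoord]

/-- Integer frame coordinates of sites: tangential coordinate. [folklore] -/
theorem tCoord_cast (k : Fin 4) (z₀ z : Site 2) : (tCoord k z₀ z : ℝ) = dirCoord (k + 1) (toComplex z - toComplex z₀) := by
  obtain ⟨hs0, hs1⟩ := cornerUnit_succ_apply k
  simp [tCoord, dirCoord, hs0, hs1]; ring

/-- The centre of a translated plaquette. [folklore] -/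
theorem plaqCentre_add (z v : Site 2) : plaqCentre (z + v) = plaqCentre z + toComplex v := by
  apply Complex.ext <;> simp [plaqCentre, toComplex, Pi.add_apply] <;> ring

/-- The centre of a run plaquette. [folklore] -/
theorem plaqCentre_runPt (c₀ : Site 2) (k : Fin 4) (n : ℤ) : plaqCentre (runPt c₀ k n) = plaqCentre c₀ + (n : ℂ) * dirVec k := by
  apply Complex.ext <;> simp [plaqCentre, runPt_apply, dirVec, toComplex] <;> ring

/-- The position of a site versus the centre of its plaquette. [folklore] -/
theorem toComplex_eq_plaqCentre_sub (z : Site 2) : toComplex z = plaqCentre z - ((1 / 2 : ℝ) : ℂ) * (1 + Complex.I) := by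
  apply Complex.ext <;> simp [plaqCentre, toComplex]

/-- **Closed squares in frame coordinates**: `w ∈ plaqClosedSq z` iff both frame coordinates of
`w - plaqCentre z` are at most `½` in absolute value. [folklore] -/
theorem mem_plaqClosedSq_iff_dirCoord (k : Fin 4) (z : Site 2) (w : ℂ) :
    w ∈ plaqClosedSq z ↔ |dirCoord k (w - plaqCentre z)| ≤ 1 / 2 ∧ |dirCoord (k + 1) (w - plaqCentre z)| ≤ 1 / 2 := by
  rw [abs_dirCoord_le_iff]
  simp only [plaqClosedSq, Set.mem_setOf_eq, Complex.sub_re, Complex.sub_im, plaqCentre, abs_le]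
  constructor
  · rintro ⟨h1, h2, h3, h4⟩; refine ⟨⟨?_, ?_⟩, ?_, ?_⟩ <;> linarith
  · rintro ⟨⟨h1, h2⟩, h3, h4⟩; refine ⟨?_, ?_, ?_, ?_⟩ <;> linarith

/-- Frame coordinates of the integer combination `a e_k + b e_{k+1}` of a site. [folklore] -/
theorem dirCoord_toComplex_frame (k : Fin 4) (a b : ℤ) :
    dirCoord k (toComplex (a • cornerUnit k + b • cornerUnit (k + 1))) = a ∧
      dirCoord (k + 1) (toComplex (a • cornerUnit k + b • cornerUnit (k + 1))) = b := by
  obtain ⟨hs0, hs1⟩ := cornerUnit_succ_apply k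
  rcases cornerUnit_apply_cases k with ⟨h0, h1⟩ | ⟨h0, h1⟩ | ⟨h0, h1⟩ | ⟨h0, h1⟩ <;>
    simp [dirCoord, toComplex, Pi.add_apply, hs0, hs1, h0, h1]

/-- The frame coordinates of the half-diagonal offset `½ (1 + i)` are `± ½`. [folklore] -/
theorem dirCoord_half_diag (k : Fin 4) :
    (dirCoord k (((1 / 2 : ℝ) : ℂ) * (1 + Complex.I)) = 1 / 2 ∨ dirCoord k (((1 / 2 : ℝ) : ℂ) * (1 + Complex.I)) = -(1 / 2)) := by
  rcases cornerUnit_apply_cases k with ⟨h0, h1⟩ | ⟨h0, h1⟩ | ⟨h0, h1⟩ | ⟨h0, h1⟩ <;>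
    simp [dirCoord, h0, h1]

end Literature.Probability.LatticeModels
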